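import Summits.ValiantsHypothesis.ValiantsHypothesis.Theorems.LacunarySymmetroidMatrixDescartesCensusDefs

/-!
# `MatrixDescartes` census — MIRROR symmetry of the support-level table (`x ↦ x⁻¹`)

HONEST FRAMING.  Object-search cell `pub-symmetroid`, route crux `Theses.LacunarySymmetroid.MatrixDescartes`
(ledger item stmt-ValiantsHypothesis-18050).  Elementary bookkeeping for the cell's support-level upper-bound
table «`ζ(m,K; d) ≤ B`» (currency `PosRootLawOn m K B d`, `…CensusDefs.lean`): every row is invariant under

* re-indexing the exponents, `d ↦ d ∘ σ` for a permutation `σ` of the `K` letters (`posRootLawOn_comp_equiv_iff`), and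
* the MIRROR `d ↦ N − d` for any `N ≥ max d` (`posRootLawOn_mirror_iff`): on `(0, ∞)` the substitution `x ↦ x⁻¹`
  turns `det (∑ l, x^(d l) • S l)` into `x^(−N m) · det (∑ l, x^(N − d l) • S l)`, a bijection of positive roots
  (`card_posRoots_det_pencil_mirror`), for ANY size `m` and any coefficient matrices (symmetric or not);

and the sorted form used by the cell's atlas, `posRootLawOn_iff_mirror_rev` (`d ↦ (N − d) ∘ Fin.rev`, so that an
increasing support `0 = d₀ < ⋯ < d_{K−1} = N` goes to the increasing support `0 = N − d_{K−1} < ⋯ < N − d₀ = N`).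
Consequently every support-level or ray certificate of the kernel column (files `…CensusTNC*.lean`,
`…CensusSignClass*.lean`, `…CensusTNCUnif*.lean`) holds verbatim for the mirror support / mirror ray, and the index
set of the door-A table (`Census.doorA26_iff_primitive`) may be read up to reversal.  Nothing here bears on the typed
targets `DoorA26` / `DoorA34` (OPEN, never asserted), on the crux `MatrixDescartes`, or on `VP ≠ VNP`.

[folklore] `det` commutes with ring homomorphisms (`RingHom.map_det`); `x ↦ x⁻¹` is a bijection of `(0, ∞)`.
-/

-- `Summit.ValiantsHypothesis.ValiantsHypothesis.…` repeats a component by the D-0017 layout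
-- (single-conjunct summit), which the `dupNamespace` linter flags; the name is mandated.
set_option linter.dupNamespace false

namespace Summit.ValiantsHypothesis.ValiantsHypothesis.Theorems.LacunarySymmetroidMatrixDescartes.Census

open Polynomial Finset
open scoped BigOperators Polynomial Matrix
open Summit.ValiantsHypothesis.ValiantsHypothesis.Theorems.MatrixDescartes.Negative (PosRootLawAt)

/-- Evaluating the determinant of the pencil `∑ l, X^(d l) • S l` at a real point `t` gives the determinant of the
real matrix `∑ l, t^(d l) • S l` (`det` commutes with the evaluation homomorphism). [folklore] -/
theorem eval_det_pencil_eq {m K : ℕ} (d : Fin K → ℕ) (S : Fin K → Matrix (Fin m) (Fin m) ℝ) (t : ℝ) :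
    ((∑ l, (X : ℝ[X]) ^ d l • (S l).map C).det).eval t = (∑ l, t ^ d l • S l).det := by
  have h := RingHom.map_det (Polynomial.evalRingHom t) (∑ l, (X : ℝ[X]) ^ d l • (S l).map C)
  rw [Polynomial.coe_evalRingHom] at h
  rw [h]
  congr 1
  ext i j
  simp only [RingHom.mapMatrix_apply, Matrix.map_apply, Matrix.sum_apply, Matrix.smul_apply,
    smul_eq_mul, Polynomial.coe_evalRingHom, Polynomial.eval_finsetSum, Polynomial.eval_mul,
    Polynomial.eval_pow, Polynomial.eval_X, Polynomial.eval_C]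

/-- **Mirror evaluation identity.**  For `x ≠ 0` and exponents `d l ≤ N`:
`det (∑ l, x^(N − d l) • S l) = (x^N)^m · det (∑ l, (x⁻¹)^(d l) • S l)`. [folklore] -/
theorem det_pencil_mirror_eval {m K : ℕ} (d : Fin K → ℕ) (N : ℕ) (hd : ∀ l, d l ≤ N)
    (S : Fin K → Matrix (Fin m) (Fin m) ℝ) (x : ℝ) (hx : x ≠ 0) :
    (∑ l, x ^ (N - d l) • S l).det = (x ^ N) ^ m * (∑ l, x⁻¹ ^ d l • S l).det := by
  have hmat : (∑ l, x ^ (N - d l) • S l) = x ^ N • (∑ l, x⁻¹ ^ d l • S l) := by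
    rw [Finset.smul_sum]
    refine Finset.sum_congr rfl fun l _ => ?_
    rw [smul_smul]
    congr 1
    rw [inv_pow, ← div_eq_mul_inv, eq_div_iff (pow_ne_zero _ hx), ← pow_add, Nat.sub_add_cancel (hd l)]
  rw [hmat, Matrix.det_smul, Fintype.card_fin]

/-- **The mirror keeps the number of positive roots** (any size `m`, any coefficient matrices): for exponents
`d l ≤ N`, `#Z₊(det ∑ X^(N − d l) • S l) = #Z₊(det ∑ X^(d l) • S l)` — `x ↦ x⁻¹` on the positive roots; if one
determinant is the zero polynomial so is the other. [folklore] -/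
theorem card_posRoots_det_pencil_mirror {m K : ℕ} (d : Fin K → ℕ) (N : ℕ) (hd : ∀ l, d l ≤ N)
    (S : Fin K → Matrix (Fin m) (Fin m) ℝ) :
    ((∑ l, (X : ℝ[X]) ^ (N - d l) • (S l).map C).det.roots.toFinset.filter (fun t => 0 < t)).card =
      ((∑ l, (X : ℝ[X]) ^ d l • (S l).map C).det.roots.toFinset.filter (fun t => 0 < t)).card := by
  set P : ℝ[X] := (∑ l, (X : ℝ[X]) ^ d l • (S l).map C).det with hP
  set Q : ℝ[X] := (∑ l, (X : ℝ[X]) ^ (N - d l) • (S l).map C).det with hQ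
  -- the two evaluation identities on `x ≠ 0`
  have keyQ : ∀ x : ℝ, x ≠ 0 → Q.eval x = (x ^ N) ^ m * P.eval x⁻¹ := by
    intro x hx
    rw [hQ, hP, eval_det_pencil_eq, eval_det_pencil_eq, det_pencil_mirror_eval d N hd S x hx]
  have keyP : ∀ x : ℝ, x ≠ 0 → P.eval x = (x ^ N) ^ m * Q.eval x⁻¹ := by
    intro x hx
    have h := keyQ x⁻¹ (inv_ne_zero hx)
    rw [inv_inv] at h
    rw [h, ← mul_assoc, ← mul_pow, ← mul_pow, mul_inv_cancel₀ hx, one_pow, one_pow, one_mul]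
  -- if one side is the zero polynomial, so is the other
  have zero_of : ∀ P' Q' : ℝ[X], (∀ x : ℝ, x ≠ 0 → Q'.eval x = (x ^ N) ^ m * P'.eval x⁻¹) → P' = 0 → Q' = 0 := by
    intro P' Q' key h0
    apply Polynomial.eq_zero_of_infinite_isRoot
    apply Set.infinite_of_injective_forall_mem (f := fun k : ℕ => ((k : ℝ) + 1))
    · intro i j hij; simpa using hij
    · intro k
      show IsRoot _ _
      rw [IsRoot.def, key _ (by positivity), h0, eval_zero, mul_zero]
  by_cases hP0 : P = 0
  · have hQ0 : Q = 0 := zero_of P Q keyQ hP0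
    rw [hP0, hQ0]
  have hQ0 : Q ≠ 0 := fun h => hP0 (zero_of Q P keyP h)
  -- bijection `x ↦ x⁻¹` from the positive roots of `Q` onto those of `P`
  refine Finset.card_bij (fun x _ => x⁻¹) ?_ ?_ ?_
  · intro x hx
    simp only [Finset.mem_filter, Multiset.mem_toFinset, mem_roots hQ0, IsRoot.def] at hx
    simp only [Finset.mem_filter, Multiset.mem_toFinset, mem_roots hP0, IsRoot.def]
    refine ⟨?_, inv_pos.mpr hx.2⟩
    have h := hx.1
    rw [keyQ x hx.2.ne'] at h
    rcases mul_eq_zero.mp h with h1 | h1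
    · exact absurd h1 (pow_ne_zero _ (pow_ne_zero _ hx.2.ne'))
    · exact h1
  · intro x _ y _ hxy
    exact inv_injective hxy
  · intro y hy
    simp only [Finset.mem_filter, Multiset.mem_toFinset, mem_roots hP0, IsRoot.def] at hy
    refine ⟨y⁻¹, ?_, inv_inv y⟩
    simp only [Finset.mem_filter, Multiset.mem_toFinset, mem_roots hQ0, IsRoot.def]
    refine ⟨?_, inv_pos.mpr hy.2⟩
    rw [keyQ _ (inv_ne_zero hy.2.ne'), inv_inv, hy.1, mul_zero]

/-- **Mirror invariance of a table row**: for `N ≥ max d`, `ζ(m,K; d) ≤ B ↔ ζ(m,K; N − d) ≤ B`. [folklore] -/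
theorem posRootLawOn_mirror_iff {m K B : ℕ} (d : Fin K → ℕ) (N : ℕ) (hd : ∀ l, d l ≤ N) :
    PosRootLawOn m K B d ↔ PosRootLawOn m K B (fun l => N - d l) := by
  constructor
  · intro h S hS
    have := h S hS
    rw [← card_posRoots_det_pencil_mirror d N hd S] at this
    exact this
  · intro h S hS
    have := h S hS
    rw [card_posRoots_det_pencil_mirror d N hd S] at this
    exact this

/-- Re-indexing the letters does not change the pencil: `∑ l, X^(d (σ l)) • S (σ l) = ∑ l, X^(d l) • S l`. [folklore] -/
theorem pencil_comp_equiv {m K : ℕ} (σ : Equiv.Perm (Fin K)) (d : Fin K → ℕ)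
    (S : Fin K → Matrix (Fin m) (Fin m) ℝ) :
    (∑ l, (X : ℝ[X]) ^ d (σ l) • (S (σ l)).map C) = ∑ l, (X : ℝ[X]) ^ d l • (S l).map C :=
  Equiv.sum_comp σ (fun l => (X : ℝ[X]) ^ d l • (S l).map C)

/-- **Permutation invariance of a table row**: `ζ(m,K; d) ≤ B ↔ ζ(m,K; d ∘ σ) ≤ B` for every permutation `σ`
of the letters (the row predicate quantifies over all coefficient tuples). [folklore] -/
theorem posRootLawOn_comp_equiv_iff {m K B : ℕ} (σ : Equiv.Perm (Fin K)) (d : Fin K → ℕ) :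
    PosRootLawOn m K B d ↔ PosRootLawOn m K B (d ∘ σ) := by
  constructor
  · intro h S hS
    have key : (∑ l, (X : ℝ[X]) ^ (d ∘ σ) l • (S l).map C)
        = ∑ l, (X : ℝ[X]) ^ d l • ((S ∘ σ.symm) l).map C := by
      rw [← pencil_comp_equiv σ d (S ∘ σ.symm)]
      refine Finset.sum_congr rfl fun l _ => ?_
      simp [Function.comp]
    rw [key]
    exact h (S ∘ σ.symm) fun l => hS _
  · intro h S hS
    have key : (∑ l, (X : ℝ[X]) ^ d l • (S l).map C)
        = ∑ l, (X : ℝ[X]) ^ (d ∘ σ) l • ((S ∘ σ) l).map C := by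
      rw [show (fun l => (X : ℝ[X]) ^ (d ∘ σ) l • ((S ∘ σ) l).map C)
            = (fun l => (X : ℝ[X]) ^ d (σ l) • (S (σ l)).map C) from rfl, pencil_comp_equiv σ d S]
    rw [key]
    exact h (S ∘ σ) fun l => hS _

/-- **Sorted mirror** (the atlas's convention): for `N ≥ max d`, `ζ(m,K; d) ≤ B ↔ ζ(m,K; (N − d) ∘ Fin.rev) ≤ B`;
for an increasing support `0 = d 0 < ⋯ < d (K−1) = N` the right-hand support is again increasing, from `0` to `N`. [folklore] -/
theorem posRootLawOn_iff_mirror_rev {m K B : ℕ} (d : Fin K → ℕ) (N : ℕ) (hd : ∀ l, d l ≤ N) :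
    PosRootLawOn m K B d ↔ PosRootLawOn m K B (fun l => N - d (Fin.rev l)) :=
  (posRootLawOn_mirror_iff d N hd).trans (posRootLawOn_comp_equiv_iff Fin.revPerm (fun l => N - d l))

/-- **Mirror pairs of the `(2,6)` table.**  A row `ζ(2,6; d) ≤ 19` on a support with `d l ≤ d 5` for all `l`
(e.g. an increasing support) gives the row on the mirror support `l ↦ d 5 − d (5 − l)`; this is how every landed
`Census.posRoots_le_19_on_2_6_…` theorem covers the mirror cell quoted next to it in the cell's atlas. [folklore] -/
theorem posRootLawOn_two_six_mirror {B : ℕ} (d : Fin 6 → ℕ) (hd : ∀ l, d l ≤ d 5)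
    (h : PosRootLawOn 2 6 B d) : PosRootLawOn 2 6 B (fun l => d 5 - d (Fin.rev l)) :=
  (posRootLawOn_iff_mirror_rev d (d 5) hd).1 h

/-- Worked instance (a check of the bookkeeping, no census content): the mirror of the record support
`(0,9,11,12,17,35)` is `(0,18,23,24,26,35)`; a row `≤ B` on one is a row `≤ B` on the other. [folklore] -/
theorem posRootLawOn_mirror_0_9_11_12_17_35 (B : ℕ) :
    PosRootLawOn 2 6 B ![0, 9, 11, 12, 17, 35] ↔ PosRootLawOn 2 6 B ![0, 18, 23, 24, 26, 35] := by
  have h := posRootLawOn_iff_mirror_rev (m := 2) (B := B) (![0, 9, 11, 12, 17, 35] : Fin 6 → ℕ) 35 (by decide)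
  have e : (fun l : Fin 6 => 35 - (![0, 9, 11, 12, 17, 35] : Fin 6 → ℕ) (Fin.rev l))
      = (![0, 18, 23, 24, 26, 35] : Fin 6 → ℕ) := by decide
  rw [e] at h
  exact h

end Summit.ValiantsHypothesis.ValiantsHypothesis.Theorems.LacunarySymmetroidMatrixDescartes.Census
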